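import Summits.CriticalPhenomena.PercolationContinuityZ3.Theorems.PercNearOneGluingNoHeavyQuantWindowTwoSided
import HarnessLib

/-!
# QUANT lane R8, T-DEC: from the two-sided move to smallness — at an EXTREME point of the window polytope a two-sided move must be
# proportional to the law, so the support of the law lies in the support of the pieces (memo WINDOW-ATOMS-G57 §2.5, file H5 part 3)

builds on p205010 (kernel theorem, internal audit signed; external expert review pending)

Support file (`--supports stmt-CriticalPhenomena-4575`), QUANT lane seat prim-quant-census-2 (gen 57), rung R8 of
`run/shared/lean/prim/quant/LADDER.md`.  Theorems only, standard axioms, no sorries.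

* `LawDec.pert_support` — where the difference `pertLaw − μ` is nonzero, an active piece sits.
* `LawDec.pertD_eq_zero_of_extreme` — if `v + α·D` and `v − β·D` both lie in `windowSet` (`α, β > 0`) and `v` is an extreme point, then
  `D = 0` (the point is in the open segment; `mem_extremePoints`).
* **`LawDec.smallLaw_of_pieces`** — `v` extreme in `windowSet`, pieces satisfying the hypotheses of `exists_oneSided`, one position `≤ M` where
  the pieces move mass, and four names (two lows, two absorbers `≤ M`) covering the positions of the pieces ⟹ `SmallLaw T j M (vecLaw M v)`.
  (The move and its negative are admissible; extremality forces `δ = (Σδ)·μ` on `{0..M}` with `Σδ ≠ 0`; so `supp μ ⊆ supp δ`.)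

[this work]; nothing here is cited as a published result.  The gluing rows served [cite: KozmaNitzan2024, Conjecture 3 (p. 15)]; product
measure [cite: Grimmett1999, §1.3 p. 10].
-/

noncomputable section

namespace Summit.CriticalPhenomena.PercolationContinuityZ3.Theorems

namespace Quant

open Finset

namespace LawDec

/-- indicator of equality of naturals, as a real number -/
local notation3 "𝟙[" a ", " b "]" => (if (a : ℕ) = (b : ℕ) then (1 : ℝ) else 0)

/-- **where the pieces move mass, an active piece sits.** [this work] -/
theorem pert_support (x T : ℝ) (j : ℕ) (μ : ℕ → ℝ) (l₁ h₁ l₂ h₂ g₁ g₂ l₀ : ℕ) (t₁ t₂ s₁ s₂ r : ℝ) (k : ℕ)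
    (hk : pertLaw x T j μ l₁ h₁ l₂ h₂ g₁ g₂ l₀ t₁ t₂ s₁ s₂ r k - μ k ≠ 0) :
    (t₁ ≠ 0 ∧ (k = l₁ ∨ k = h₁)) ∨ (t₂ ≠ 0 ∧ (k = l₂ ∨ k = h₂)) ∨ (s₁ ≠ 0 ∧ k = g₁) ∨ (s₂ ≠ 0 ∧ k = g₂) ∨ (r ≠ 0 ∧ k = l₀) := by
  by_contra hn
  push Not at hn
  obtain ⟨n1, n2, n3, n4, n0⟩ := hn
  apply hk
  unfold pertLaw
  have z1 : t₁ * (𝟙[k, l₁] + usage x T j l₁ h₁ * 𝟙[k, h₁]) = 0 := by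
    by_cases ht : t₁ = 0
    · rw [ht, zero_mul]
    · obtain ⟨a, b⟩ := n1 ht; rw [if_neg a, if_neg b]; ring
  have z2 : t₂ * (𝟙[k, l₂] + usage x T j l₂ h₂ * 𝟙[k, h₂]) = 0 := by
    by_cases ht : t₂ = 0
    · rw [ht, zero_mul]
    · obtain ⟨a, b⟩ := n2 ht; rw [if_neg a, if_neg b]; ring
  have z3 : s₁ * 𝟙[k, g₁] = 0 := by
    by_cases hs : s₁ = 0
    · rw [hs, zero_mul]
    · rw [if_neg (n3 hs), mul_zero]
  have z4 : s₂ * 𝟙[k, g₂] = 0 := by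
    by_cases hs : s₂ = 0
    · rw [hs, zero_mul]
    · rw [if_neg (n4 hs), mul_zero]
  have z0 : r * 𝟙[k, l₀] = 0 := by
    by_cases hr : r = 0
    · rw [hr, zero_mul]
    · rw [if_neg (n0 hr), mul_zero]
  rw [z1, z2, z3, z4, z0]; ring

/-- **at an extreme point a two-sided admissible direction vanishes.** [this work] -/
theorem dir_eq_zero_of_extreme {M : ℕ} {P : Set (Fin (M + 1) → ℝ)} {v : Fin (M + 1) → ℝ} (hv : v ∈ P.extremePoints ℝ)
    (D : Fin (M + 1) → ℝ) {α β : ℝ} (hα : 0 < α) (hβ : 0 < β)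
    (hplus : (fun i => v i + α * D i) ∈ P) (hminus : (fun i => v i - β * D i) ∈ P) : ∀ i, D i = 0 := by
  have hseg : v ∈ openSegment ℝ (fun i => v i - β * D i) (fun i => v i + α * D i) := by
    refine ⟨α / (α + β), β / (α + β), div_pos hα (by linarith), div_pos hβ (by linarith), ?_, ?_⟩
    · field_simp
    · funext i
      simp only [Pi.add_apply, Pi.smul_apply, smul_eq_mul]
      field_simp
      ring
  have h := ((mem_extremePoints.1 hv).2 _ hminus _ hplus hseg).2
  intro i
  have hi : v i + α * D i = v i := congrFun h i
  nlinarith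

/-- **SMALLNESS FROM THE PIECES** (memo §2.5): at an extreme point of the window polytope, admissible pieces (hypotheses of
`exists_oneSided`) that move mass at some position `≤ M`, and four names covering the positions of the pieces, give `SmallLaw`. [this work] -/
theorem smallLaw_of_pieces (x T : ℝ) (M j w : ℕ) (v : Fin (M + 1) → ℝ) (hx0 : 0 < x) (hx1 : x < 1)
    (hvext : v ∈ (windowSet x T M j w).extremePoints ℝ) (l₁ h₁ l₂ h₂ g₁ g₂ l₀ : ℕ) (t₁ t₂ s₁ s₂ r : ℝ)
    (hσ₁ : t₁ ≠ 0 → 0 < cornerMidFlow x T j M (vecLaw M v) l₁ h₁)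
    (hσ₂ : t₂ ≠ 0 → 0 < cornerMidFlow x T j M (vecLaw M v) l₂ h₂)
    (hg₁ : s₁ ≠ 0 → g₁ ≤ M ∧ ¬ (2 * (g₁ : ℝ) < T ∧ g₁ ≤ j) ∧
      0 < vecLaw M v g₁ - ∑ a ∈ Finset.range (j + 1), usage x T j a g₁ * cornerMidFlow x T j M (vecLaw M v) a g₁)
    (hg₂ : s₂ ≠ 0 → g₂ ≤ M ∧ ¬ (2 * (g₂ : ℝ) < T ∧ g₂ ≤ j) ∧
      0 < vecLaw M v g₂ - ∑ a ∈ Finset.range (j + 1), usage x T j a g₂ * cornerMidFlow x T j M (vecLaw M v) a g₂)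
    (hl₀ : r ≠ 0 → 2 * (l₀ : ℝ) < T ∧ l₀ ≤ j ∧ 0 < cornerLeftover x T j M (vecLaw M v) l₀)
    (hG : ∀ J, J ≤ j → j ≤ J + w → (∀ l, J < l → l ≤ j → 2 * (l : ℝ) < T → vecLaw M v l = 0) →
      x / (1 - x) * windowS x T j M (vecLaw M v) J = ∑ h ∈ Finset.Ico (J + 1) (M + 1), vecLaw M v h →
      0 < ∑ h ∈ Finset.Ico (J + 1) (M + 1), vecLaw M v h →
      pieceG x T j M l₁ h₁ l₂ h₂ g₁ g₂ t₁ t₂ s₁ s₂ r J = 0)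
    (bstar : ℕ) (hbM : bstar ≤ M)
    (hbne : pertLaw x T j (vecLaw M v) l₁ h₁ l₂ h₂ g₁ g₂ l₀ t₁ t₂ s₁ s₂ r bstar - vecLaw M v bstar ≠ 0)
    (l l' h h' : ℕ) (hhM : h ≤ M) (hh'M : h' ≤ M) (hh : T ≤ 2 * (h : ℝ) ∨ j + 1 ≤ h) (hh' : T ≤ 2 * (h' : ℝ) ∨ j + 1 ≤ h')
    (hnames : ∀ k, pertLaw x T j (vecLaw M v) l₁ h₁ l₂ h₂ g₁ g₂ l₀ t₁ t₂ s₁ s₂ r k - vecLaw M v k ≠ 0 →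
      (k = l ∨ k = l' ∨ k = h ∨ k = h')) :
    SmallLaw T j M (vecLaw M v) := by
  have hv : v ∈ windowSet x T M j w := hvext.1
  -- the move and its negative
  obtain ⟨α, hα, hplus⟩ := exists_oneSided x T M j w v hx0 hx1 hv l₁ h₁ l₂ h₂ g₁ g₂ l₀ t₁ t₂ s₁ s₂ r hσ₁ hσ₂ hg₁ hg₂ hl₀ hG
  obtain ⟨β, hβ, hminus⟩ := exists_oneSided x T M j w v hx0 hx1 hv l₁ h₁ l₂ h₂ g₁ g₂ l₀ (-t₁) (-t₂) (-s₁) (-s₂) (-r)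
    (fun ht => hσ₁ (fun h0 => ht (by rw [h0, neg_zero]))) (fun ht => hσ₂ (fun h0 => ht (by rw [h0, neg_zero])))
    (fun hs => hg₁ (fun h0 => hs (by rw [h0, neg_zero]))) (fun hs => hg₂ (fun h0 => hs (by rw [h0, neg_zero])))
    (fun hr => hl₀ (fun h0 => hr (by rw [h0, neg_zero])))
    (fun J hJ hw hgap hS hΓ => by rw [pieceG_neg, hG J hJ hw hgap hS hΓ, neg_zero])
  have hminus' : (fun i : Fin (M + 1) => v i - β * pertD x T j M v l₁ h₁ l₂ h₂ g₁ g₂ l₀ t₁ t₂ s₁ s₂ r i) ∈ windowSet x T M j w := by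
    have e : (fun i : Fin (M + 1) => v i + β * pertD x T j M v l₁ h₁ l₂ h₂ g₁ g₂ l₀ (-t₁) (-t₂) (-s₁) (-s₂) (-r) i)
        = fun i : Fin (M + 1) => v i - β * pertD x T j M v l₁ h₁ l₂ h₂ g₁ g₂ l₀ t₁ t₂ s₁ s₂ r i := by
      funext i; rw [pertD_neg]; ring
    rw [e] at hminus; exact hminus
  -- extremality: the direction vanishes on `{0..M}`
  have hD := dir_eq_zero_of_extreme hvext (fun i => pertD x T j M v l₁ h₁ l₂ h₂ g₁ g₂ l₀ t₁ t₂ s₁ s₂ r i) hα hβ hplus hminus'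
  -- so δ = (Σ δ)·μ on {0..M}, with Σ δ ≠ 0
  set δ : ℕ → ℝ := fun b => pertLaw x T j (vecLaw M v) l₁ h₁ l₂ h₂ g₁ g₂ l₀ t₁ t₂ s₁ s₂ r b - vecLaw M v b with hδ
  set s : ℝ := ∑ k ∈ Finset.range (M + 1), δ k with hs
  have hprop : ∀ b, b ≤ M → δ b = s * vecLaw M v b := by
    intro b hb
    have := hD ⟨b, Nat.lt_succ_of_le hb⟩
    unfold pertD at this
    simp only at this
    linarith
  have hs0 : s ≠ 0 := by
    intro hz
    have := hprop bstar hbM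
    rw [hz, zero_mul] at this
    exact hbne this
  refine ⟨l, l', h, h', hhM, hh'M, hh, hh', fun k hk => hnames k ?_⟩
  have hkM : k ≤ M := by
    by_contra hgt; push Not at hgt
    exact hk (vecLaw_apply_of_gt v hgt)
  show δ k ≠ 0
  rw [hprop k hkM]
  exact mul_ne_zero hs0 hk

end LawDec

end Quant

end Summit.CriticalPhenomena.PercolationContinuityZ3.Theorems
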